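import Summits.Ventures.PercRepro.RLSRuleKFourDemand
import Summits.Ventures.PercRepro.RLSZeroWorldT1E
import Summits.Ventures.PercRepro.RLSZeroWorldT0K
import Summits.Ventures.PercRepro.RLSPlanesT2_2
import Summits.Ventures.PercRepro.RLSPlanesT3_1
import Summits.Ventures.PercRepro.RLSSmallP

/-!
# C-025 at q = 3: `R₃⁺` on the `K₄`-plane at EVERY type on the core (night-3, gen 4)

The binding plane of the lane (mine-4 4785).  `t = 0`: all four lines charged, `U0.t0_k4` (demand `38`); `t = 1`:
`W1.t1_k4` (demand `37`); `t = 2`: no loss, demand `31`, `U2.Planes2.plane15_t2` (`n ≥ 6`), `SmallP.plane15_t2_n5`,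
and at `n = 4` (`p = 8`) the EXACT shares `ρ₃(B′)/(C(b + x, 3) − #lines in B′)` evaluated exactly
(`kFour_supply_exact`; the crude form is `1.7 %` short there — the landed census cell `Cells.k4_t2_p8`);
`t = 3`: demand `12`, `U3.Planes1.plane15_t3`; `t ≥ 4`: no demand.

**`perFlat_kFour_all`**: on `Core M (n + 4)`, `n ≥ 4`, every `K₄`-plane satisfies the per-flat inequality of `R₃⁺`.
Imports `RLSRuleKFourDemand`, `RLSZeroWorldT1E`, `RLSZeroWorldT0K`, the landed tables `RLSPlanesT2_2`, `RLSPlanesT3_1`,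
`RLSSmallP`.  Axioms: standard.
-/

open scoped Matroid

namespace PercRepro

namespace NightThree

open Finset ThmH PerFlat

variable {α : Type*} [DecidableEq α] {M : Matroid α} [M.Finite]

/-! ### The exact-share accounting (no loss) -/

open scoped Classical in
/-- **The exact accounting of the `K₄`-plane with no loss**: `16·Σ 1/C(3+x,3) + 12·Σ 3/(C(4+x,3) − 1) + 3·Σ 4/C(4+x,3)
+ 6·Σ 8/(C(5+x,3) − 2) + Σ 1 ≤ Σ_{S ∈ Yq} w⁺(G, S)`. -/
theorem kFour_supply_exact {p : ℕ} (hc : Core M p) {G K : Finset α} {L : Finset (Finset α)} {n : ℕ}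
    (hG : G ∈ flatsQ M 3) (h : KFour M G L) (hKsub : K ⊆ gr M \ G) (hKind : M.Indep (K : Set α))
    (hemp : ∀ ℓ ∈ L, coplanarTriples M ℓ K = ∅) :
    16 * (∑ X ∈ witnessFamily K n, 1 / (((3 + X.card).choose 3 : ℕ) : ℚ))
    + 12 * (∑ X ∈ witnessFamily K n, 3 / ((((4 + X.card).choose 3 : ℕ) : ℚ) - 1))
    + 3 * (∑ X ∈ witnessFamily K n, 4 / (((4 + X.card).choose 3 : ℕ) : ℚ))
    + 6 * (∑ X ∈ witnessFamily K n, 8 / ((((5 + X.card).choose 3 : ℕ) : ℚ) - 2))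
    + (∑ _X ∈ witnessFamily K n, (1 : ℚ))
    ≤ ∑ S ∈ Yq M (n + 4) 3, wPlus M G S := by
  obtain ⟨hmem3, h𝔅rank, hd34, hd5, hd6, hc3, hc4, hc5⟩ := kFour_family hc hG h
  have hdep := depTriples_eq_of_kFour h
  have h' := h
  obtain ⟨hGc, hLc, hL, hdeg, hind⟩ := h
  have hKG : Disjoint K G := by
    rw [Finset.disjoint_left]
    intro x hxK hxG
    have := hKsub hxK
    rw [Finset.mem_sdiff] at this
    exact this.2 hxG
  have hgood : ∀ X, ∀ ℓ ∈ depTriples M G, GoodWitness M ℓ K X := by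
    intro X ℓ hℓ C hC
    rw [hdep] at hℓ
    rw [hemp ℓ hℓ] at hC
    exact absurd hC (Finset.notMem_empty C)
  -- the exact share function
  set f : Finset α → Finset α → ℚ := fun B X =>
    if B.card ≤ 5 then (rho3 M B : ℚ) / ((((B.card + X.card).choose 3 : ℕ) : ℚ) - ((L.filter (fun ℓ => ℓ ⊆ B)).card : ℚ))
    else 1 with hf
  have hdepB : ∀ B ⊆ G, ((B.powersetCard 3).filter (fun (T : Finset α) => ¬ M.Indep (T : Set α))).card =
      (L.filter (fun ℓ => ℓ ⊆ B)).card := by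
    intro B hB
    congr 1
    ext T
    simp only [Finset.mem_filter, Finset.mem_powersetCard]
    constructor
    · rintro ⟨⟨hTB, hTc⟩, hdep'⟩
      have : T ∈ depTriples M G := by
        unfold depTriples; rw [Finset.mem_filter, Finset.mem_powersetCard]; exact ⟨⟨hTB.trans hB, hTc⟩, hdep'⟩
      rw [hdep] at this
      exact ⟨this, hTB⟩
    · rintro ⟨hT, hTB⟩
      obtain ⟨_, hTc, hTr⟩ := hL T hT
      exact ⟨⟨hTB, hTc⟩, not_indep_of_eRk_two_card_three hTr hTc⟩
  have hsup := supply_ge_of_family hG h𝔅rank hKsub hKind n f (fun B hB X hX => by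
    obtain ⟨hXK, _, _⟩ := mem_witnessFamily hX
    have hXind : M.Indep (X : Set α) := hKind.subset (Finset.coe_subset.2 hXK)
    have hXG : Disjoint X G := Finset.disjoint_of_subset_left hXK hKG
    have hBG := (h𝔅rank B hB).1
    rw [hf]
    dsimp only
    by_cases h5 : B.card ≤ 5
    · rw [if_pos h5]
      have hw := wPlus_ge_of_good_exact hc hG hBG h5 hXind hXG hXK (fun ℓ hℓ _ => hgood X ℓ hℓ)
      rw [hdepB B hBG] at hw
      exact hw
    · rw [if_neg h5]
      have hB6 : B.card = 6 := by
        have := Finset.card_le_card hBG; omega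
      exact le_of_eq (wPlus_eq_one_of_six_good hc hG hBG hB6 hXind hXG hXK (fun ℓ hℓ _ => hgood X ℓ hℓ)).symm)
  refine le_trans ?_ hsup
  -- the pieces
  have h3 : ∑ B ∈ (G.powersetCard 3).filter (fun T => T ∉ L), ∑ X ∈ witnessFamily K n, f B X =
      16 * (∑ X ∈ witnessFamily K n, 1 / (((3 + X.card).choose 3 : ℕ) : ℚ)) := by
    have hv : ∀ B ∈ (G.powersetCard 3).filter (fun T => T ∉ L), ∑ X ∈ witnessFamily K n, f B X =
        ∑ X ∈ witnessFamily K n, 1 / (((3 + X.card).choose 3 : ℕ) : ℚ) := by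
      intro B hB
      obtain ⟨hBG, hBc, hnl, _⟩ := hmem3 B hB
      have hj : (L.filter (fun ℓ => ℓ ⊆ B)).card = 0 := by
        rw [Finset.card_eq_zero, Finset.filter_eq_empty_iff]; exact hnl
      have hr := rho3_eq_of_kFour h' hBG
      rw [hj, hBc, Nat.choose_self] at hr
      apply Finset.sum_congr rfl
      intro X _
      rw [hf]; dsimp only
      rw [if_pos (by omega), hj, hBc, show rho3 M B = 1 by omega]
      simp
    rw [Finset.sum_congr rfl hv, Finset.sum_const, hc3, nsmul_eq_mul]; norm_num
  have h4 : ∑ B ∈ G.powersetCard 4, ∑ X ∈ witnessFamily K n, f B X =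
      12 * (∑ X ∈ witnessFamily K n, 3 / ((((4 + X.card).choose 3 : ℕ) : ℚ) - 1))
      + 3 * (∑ X ∈ witnessFamily K n, 4 / (((4 + X.card).choose 3 : ℕ) : ℚ)) := by
    have hv : ∀ B ∈ G.powersetCard 4, ∑ X ∈ witnessFamily K n, f B X =
        (if ∃ ℓ ∈ L, ℓ ⊆ B then ∑ X ∈ witnessFamily K n, 3 / ((((4 + X.card).choose 3 : ℕ) : ℚ) - 1)
          else ∑ X ∈ witnessFamily K n, 4 / (((4 + X.card).choose 3 : ℕ) : ℚ)) := by
      intro B hB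
      obtain ⟨hBG, hBc⟩ := Finset.mem_powersetCard.1 hB
      have hj1 := lines_subset_four_kFour hc hG h' hBG hBc
      have hr := rho3_eq_of_kFour h' hBG
      rw [hBc, show Nat.choose 4 3 = 4 by norm_num [Nat.choose]] at hr
      by_cases hex : ∃ ℓ ∈ L, ℓ ⊆ B
      · rw [if_pos hex]
        have hj : (L.filter (fun ℓ => ℓ ⊆ B)).card = 1 := by
          obtain ⟨ℓ, hℓ, hl⟩ := hex
          have : 0 < (L.filter (fun ℓ => ℓ ⊆ B)).card := Finset.card_pos.2 ⟨ℓ, Finset.mem_filter.2 ⟨hℓ, hl⟩⟩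
          omega
        rw [hj] at hr
        apply Finset.sum_congr rfl
        intro X _
        rw [hf]; dsimp only
        rw [if_pos (by omega), hj, hBc, show rho3 M B = 3 by omega]
        norm_num
      · rw [if_neg hex]
        have hj : (L.filter (fun ℓ => ℓ ⊆ B)).card = 0 := by
          rw [Finset.card_eq_zero, Finset.filter_eq_empty_iff]
          intro ℓ hℓ hl; exact hex ⟨ℓ, hℓ, hl⟩
        rw [hj] at hr
        apply Finset.sum_congr rfl
        intro X _
        rw [hf]; dsimp only
        rw [if_pos (by omega), hj, hBc, show rho3 M B = 4 by omega]
        norm_num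
    rw [Finset.sum_congr rfl hv, ← Finset.sum_filter_add_sum_filter_not (G.powersetCard 4) (fun B => ∃ ℓ ∈ L, ℓ ⊆ B),
      Finset.sum_congr rfl (fun B hB => if_pos (Finset.mem_filter.1 hB).2),
      Finset.sum_congr rfl (fun B hB => if_neg (Finset.mem_filter.1 hB).2),
      Finset.sum_const, Finset.sum_const, card_lined_four_kFour hc hG h']
    have hrest : ((G.powersetCard 4).filter (fun B => ¬ ∃ ℓ ∈ L, ℓ ⊆ B)).card = 3 := by
      have := Finset.card_filter_add_card_filter_not (s := G.powersetCard 4) (fun B => ∃ ℓ ∈ L, ℓ ⊆ B)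
      rw [card_lined_four_kFour hc hG h', hc4] at this
      omega
    rw [hrest]
    simp only [nsmul_eq_mul]
    push_cast
    ring
  have h5 : ∑ B ∈ G.powersetCard 5, ∑ X ∈ witnessFamily K n, f B X =
      6 * (∑ X ∈ witnessFamily K n, 8 / ((((5 + X.card).choose 3 : ℕ) : ℚ) - 2)) := by
    have hv : ∀ B ∈ G.powersetCard 5, ∑ X ∈ witnessFamily K n, f B X =
        ∑ X ∈ witnessFamily K n, 8 / ((((5 + X.card).choose 3 : ℕ) : ℚ) - 2) := by
      intro B hB
      obtain ⟨hBG, hBc⟩ := Finset.mem_powersetCard.1 hB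
      have hj := card_lines_in_five_kFour h' hBG hBc
      have hr := rho3_eq_of_kFour h' hBG
      rw [hBc, hj, show Nat.choose 5 3 = 10 by norm_num [Nat.choose]] at hr
      apply Finset.sum_congr rfl
      intro X _
      rw [hf]; dsimp only
      rw [if_pos (by omega), hj, hBc, show rho3 M B = 8 by omega]
      norm_num
    rw [Finset.sum_congr rfl hv, Finset.sum_const, hc5, nsmul_eq_mul]; norm_num
  have h6 : ∑ X ∈ witnessFamily K n, f G X = ∑ _X ∈ witnessFamily K n, (1 : ℚ) := by
    apply Finset.sum_congr rfl; intro X _; rw [hf]; dsimp only; rw [if_neg (by omega)]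
  rw [Finset.sum_union hd6, Finset.sum_union hd5, Finset.sum_union hd34, Finset.sum_singleton, h3, h4, h5, h6]
  linarith

end NightThree

end PercRepro
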